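import Summits.BirchSwinnertonDyer.BirchSwinnertonDyer.Theorems.EisensteinPrimesBSDpOnCellCOfNamedFactsV17P
import Summits.BirchSwinnertonDyer.BirchSwinnertonDyer.Theorems.EisensteinPrimesBSDpOnCellCTelescopeCarrierSplit
import Summits.BirchSwinnertonDyer.BirchSwinnertonDyer.Theorems.SignedBaseChangeAnticyclotomicEisensteinDivisibilitySpecializationHerbrand
import Summits.BirchSwinnertonDyer.Rank1Residual.X11b.BDPRouteOpenInputDegenerateFrame
import Literature.NumberTheory.EllipticCurves.IwasawaAlgebraRankOneIdealProofs
import Literature.NumberTheory.EllipticCurves.IwasawaSelmerIsTorsionProofs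
import HarnessLib

/-!
# Sub-skeleton «K2-int» UNDER the research stub `stub_carrierAlgW` (K2-W) of line «telescope» (v4 registered 645c0fbc…, v5 announced) for crux 4 `BSDpOnCellC` (item stmt-BirchSwinnertonDyer-19034) — ideator bsd-idea-12 g31, crux idea «k2-classical» rev 1.5

UNREGISTERED WORKFILE (W-79: publish-only; the skeleton of record `Lines/telescope.lean` and its stubs are untouched; the LEAD
cruxlead-19034 decides whether anything here is folded). Nothing in this file proves the crux, a registered stub unconditionally,
or any summit statement; BSD is proved for no curve. `lean check`: sorries ONLY in the one `theorem stub_carrierDivInt`.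

## What this file shows (two facts about K2-W, both kernel-checked)

1. **The integral F-level statement suffices.** `stub_carrierDivInt` (K2-D♭) is K2-W with the module REMOVED and the
   coefficients made INTEGRAL: a two-variable series `F₀ ∈ ℤ_p⟦X⟧⟦T⟧` (inner `X` = weight, outer `T` = anticyclotomic) with
   (nondeg) `X ∤ F₀`, (alg∞) `p^j·F₀(0,T) ∈ char_Λ(X_ac(E/K))·𝓞_{ℂ_p}⟦T⟧`, and per member `k` a NON-ZERO fibre
   `Φ₀ = F₀(x_k, T) ∈ ℤ_p⟦T⟧` (stated remainder-style, `Φ₀ ≡ F₀ mod (X − x_k)`, no evaluation map in the statement) with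
   `p^j·char(X(g_k))·𝓞_{ℂ_p}⟦T⟧ ⊆ (Φ₀)`. The sorry-free kernel `carrierAlgW_of_divInt : K2-D♭ → K2-W` (K2-W = the registered
   stub text VERBATIM) takes `F := F₀` mapped along `toUnr : ℤ_p → R₀` and the CYCLIC witness `𝒩 := R₀⟦X⟧⟦T⟧ ⧸ (F)`:
   `char 𝒩 = (F)` (`charIdeal_quotient_span_singleton`), the regularity element is `F` itself, and the member fibre is
   `𝒩/(X − x_k)𝒩 ≃ R₀⟦T⟧ ⧸ (F(x_k,T))` by x2-p2 g18's landed `RetractionSpecialization.nonempty_quotSMulTop_quotient_linearEquiv'`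
   (p729512) along the evaluation retraction of the landed `TelescopeCarrierAlgOfWitness` §E (p729576), so that (ctrl_k) is K2-D♭'s
   fibre inclusion read in `𝓞_{ℂ_p}⟦T⟧` (`R1.map_unrToCpInt_map_toUnr`).
   CONSEQUENCE (for the LEAD, not acted on here): the `∃ 𝒩` of K2-W carries no constraint beyond the fibre divisibilities of `F`
   — given the landed `carrierAlg_of_witness` + `stub_herbrandTranslate` (now a tree theorem), K2-W, v3's `stub_carrierAlg` and
   K2-D♭ (up to `ℤ_p`-rationality of `F`) are inter-derivable; the MODULE-LEVEL content (big Selmer dual of the Hida branch,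
   two-sided Herbrand, control) lives one level down, inside any classical proof of K2-D♭ (card «k2-classical» rev 1.5, C1♭–C6♭).
2. **Why integral coefficients (the typing finding of rev 1.5).** A classical witness for K2-W cannot be built over
   `R₀ = unrIntegers p` (`W(𝔽̄_p)`, residue field INFINITE): the tree's `XBig` is the abstract Pontryagin dual
   `CharacterModule (selmerBig …)` and is finitely generated over `𝒪⟦T⟧` only for coefficient rings `𝒪` finite over `ℤ_p`;
   control "defects" over `R₀⟦T⟧` are finite-LENGTH, not finite. The Hida branch through `f_E` has a `ℤ_p`-integral disc chart
   (`f_E` has rational coefficients; GS93 §2), the members' weights `x_k` are in `ℤ_p` (the package's `x : ℕ → ℤ_[p]`), and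
   `X_ac(E/K)` is over `ℤ_p⟦T⟧`; so the classical objects live over `ℤ_p⟦X⟧⟦T⟧` and ONLY `F` travels to `R₀⟦X⟧⟦T⟧` (to meet the
   BDP `L`, which genuinely has `R₀`-coefficients). K2-D♭ is that integral statement; no flatness / base change of modules is needed
   because of fact 1.

Stub census of this sub-skeleton: ONE stub `stub_carrierDivInt` [CONTENT, research — the F-level residual of K2-W over `ℤ_p`;
classical decomposition C1♭–C6♭ in `Cruxes/BSDpOnCellC/Ideas/k2-classical.md` rev 1.5 / `K2ClassicalSketch.lean`].
Sources: Greenberg–Stevens, Invent. Math. 111 (1993) §2 (disc chart, `𝕋` over `A(U)`); Hida, Invent. Math. 85 (1986) (the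
branch, étale at arithmetic points of weight ≥ 2); Ochiai, Compos. Math. 142 (2006) §§5–7; Delbourgo, LMS LN 356 (2008) Ch. 7, 10;
Skinner–Urban, Invent. Math. 195 (2014) §3.1.6 / Cor. 3.2.9 (char ideals and base change); Castella, Math. Ann. (2018) erratum §2
(`X^Σ_ac`, `Λ^ur`). [cite: GreenbergStevens1993, §2] [cite: Ochiai2006, Prop. 5.1, Lemma 7.2] [cite: Delbourgo2008, Thm. 7.15, Lemma 10.5]
[cite: SkinnerUrban2014, Cor. 3.2.9] [cite: Castella2018Erratum, §2 (2.5)]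
-/

set_option autoImplicit false
set_option linter.dupNamespace false

noncomputable section

open scoped Classical MatrixGroups ModularForm

open CongruenceSubgroup WeierstrassCurve NumberField IsDedekindDomain Field PowerSeries
  Literature.NumberTheory.EllipticCurves Literature.NumberTheory.EllipticCurves.GreenbergSelmer
  Literature.NumberTheory.EllipticCurves.ModularForms Literature.NumberTheory.QuadraticFields
  Literature.NumberTheory.EllipticCurves.Rank1Residual
  Literature.NumberTheory.EllipticCurves.Rank1Residual.Typed
  Literature.NumberTheory.EllipticCurves.KrizLi2019
  Literature.NumberTheory.EllipticCurves.GreenbergVatsal2000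
  Literature.NumberTheory.EllipticCurves.Wuthrich2014
  Literature.NumberTheory.EllipticCurves.SteinWuthrich2013
  Literature.NumberTheory.EllipticCurves.Castella2018Exceptional
  Literature.NumberTheory.GaloisRepresentations Literature.NumberTheory.GaloisCohomology
  Literature.NumberTheory.Automorphic
  Summit.BirchSwinnertonDyer.Rank1Residual.X11b.AcSelmer
  Summit.BirchSwinnertonDyer.Rank1Residual.X11b.Halves
  Summit.BirchSwinnertonDyer.Rank1Residual.X11b
  Summit.BirchSwinnertonDyer.Rank1Residual Summit.BirchSwinnertonDyer.Rank1Residual.X1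
  Summit.BirchSwinnertonDyer.Rank1Residual.X2
open Literature.NumberTheory.EllipticCurves.KellerYin2024 (curveLocalLambda)


open Literature.NumberTheory.EllipticCurves.BigGaloisRep


open Literature.NumberTheory.EllipticCurves.BigGaloisRep


namespace Summit.BirchSwinnertonDyer.BirchSwinnertonDyer.Cruxes.BSDpOnCellC.Telescope.K2Int

open Literature.NumberTheory.EllipticCurves.CastellaGrossiLeeSkinner2022 Literature.NumberTheory.EllipticCurves.Castella2018
  Literature.NumberTheory.IwasawaTheory Literature.NumberTheory.IwasawaTheory.Greenberg2016
  Literature.NumberTheory.IwasawaTheory.Greenberg2006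
  Summit.BirchSwinnertonDyer.Rank1Residual.X1.KellerYinMuLambdaSplit
open Literature.NumberTheory.EllipticCurves.KellerYin2024
open Summit.BirchSwinnertonDyer.BirchSwinnertonDyer.Theorems

/-! ## §S The one stub: K2-D♭ (integral F-level carrier divisibilities) -/

/-- **stub_carrierDivInt** (K2-D♭) [CONTENT — research; the `ℤ_p`-INTEGRAL, MODULE-FREE form of the registered `stub_carrierAlgW` (K2-W):
same road-R-β prefix and the same analytic-package hypothesis TOKEN FOR TOKEN; conclusion: a two-variable `F₀ ∈ ℤ_p⟦X⟧⟦T⟧` with (nondeg)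
`X ∤ F₀`, (alg∞) `p^j·F₀(0,T) ∈ Ch_Λ(X_ac(E/K))·𝓞_{ℂ_p}⟦T⟧`, and for every member `k` a non-zero fibre `Φ₀ ≡ F₀ (mod X − x_k)`,
`Φ₀ ∈ ℤ_p⟦T⟧`, with `p^j·Ch(X(g_k))·𝓞_{ℂ_p}⟦T⟧ ⊆ (Φ₀)`. Classically `F₀` = the characteristic series of the big dual Selmer module
`X₂ = X^{𝔭̄-str}_{ac}(𝕋_U ⊗ Λ^∨(Ψ⁻¹))` of the Hida branch through `f_E` on a `ℤ_p`-integral weight disc `U`; (nondeg) = `X_ac(E/K)` is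
`Λ`-torsion + control at `X = 0`; (alg∞) = two-sided Herbrand at `X = 0` + purity of `X₂[X]` + control; the fibre clause = one-sided
Herbrand (x2-p2 g18's landed `stub_herbrandTranslate`, instance `A = ℤ_p⟦T⟧`, `B = ℤ_p⟦X⟧⟦T⟧`) + Greenberg–Ochiai control at the
crystalline member `g_k` + `𝕋_U ⊗ κ(x_k) ≃ T_{g_k}` up to isogeny (card «k2-classical» rev 1.5, items C1♭–C6♭).
Why it might fail: an infinite LOCAL control defect at `𝔭̄` at some member `k` (the members are increasingly anomalous:
`a_p(g_k) → a_p(E) = 1`), which would put a non-`p`-power factor between `F₀(x_k,T)` and `Ch(X(g_k))`; `X_ac(E/K)` not `Λ`-torsion on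
Cell C (then `X ∣ F₀`); the branch's integral disc chart needing a coefficient ring `𝒪 ⊋ ℤ_p` (harmless: replace `ℤ_[p]` by `𝒪`).
Sources: [cite: GreenbergStevens1993, §2, Thm. 2.?(disc `U`, `𝕋`)] [cite: Ochiai2006, Prop. 5.1, Lemma 7.2, Cor. 7.5]
[cite: Delbourgo2008, Thm. 7.15, Lemma 10.5, Prop. 10.10] [cite: Howard2007, Thm. 3] [cite: Castella2018Erratum, §2]] -/
theorem stub_carrierDivInt :
    ∀ (W : WeierstrassCurve ℚ) [W.IsElliptic] [W.IsGloballyMinimal] (p : ℕ) [Fact p.Prime],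
    ∀ (N : ℕ) [NeZero N] (K : Type) [Field K] [NumberField K] (Dt : ModularParametrizationData W N)
      (H : HeegnerDatum N (NumberField.discr K)) (ιK : K →+* ℂ) (P : (W.baseChange K).toAffine.Point),
      CellC W p → W.conductorNorm ℤ = N →
      IsImaginaryQuadratic K → NumberField.discr K < -4 → SatisfiesHeegnerHypothesis N K →
      (W.quadraticTwist (NumberField.discr K : ℚ)).entireLFunction 1 ≠ 0 →
      WeierstrassCurve.Affine.Point.map ιK.toRatAlgHom P = heegnerPointComplex Dt H →
      ¬ (p : ℤ) ∣ Dt.c → ¬ IsOfFinAddOrder P →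
      Odd (NumberField.discr K) →
      ∀ (κ : ZpExtension K p), κ.IsAnticyclotomic →
        ∀ (γ : Field.absoluteGaloisGroup K) [Fact (κ.IsTopGenerator γ)]
          (𝔭 : HeightOneSpectrum (𝓞 K)), ((p : ℕ) : 𝓞 K) ∈ 𝔭.asIdeal →
          𝔭.asIdeal.ramificationIdx (𝓞 ℚ) = 1 → 𝔭.asIdeal.inertiaDeg (𝓞 ℚ) = 1 →
          ∀ (𝔭bar : HeightOneSpectrum (𝓞 K)), ((p : ℕ) : 𝓞 K) ∈ 𝔭bar.asIdeal → 𝔭bar ≠ 𝔭 →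
            ((Ideal.span {(p : ℤ)}).primesOver (𝓞 K)).ncard = 2 →
          ∀ (f : CuspForm (CongruenceSubgroup.Gamma0 N) 2), IsNewformOf W f →
            ∀ (ι' : PadicAlgCl p ≃+* ℂ),
              (∀ (w : InfinitePlace K) (k : 𝓞 K),
                k ∈ 𝔭.asIdeal ↔ ‖ι'.symm (w.embedding (k : K))‖ < 1) →
              ∀ (ΩK : ℂ) (Ωp : ℂ_[p]) (Q : PowerSeries 𝓞_ℂ_[p]), ΩK ≠ 0 → ‖Ωp‖ = 1 →
                R1.IsBDPLFunctionInt p ι' 𝔭 κ γ f ΩK Ωp Q →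
      ∀ (L : PowerSeries (PowerSeries (unrIntegers p))) (x : ℕ → ℤ_[p]) (D : ℕ → Skinner2016.HidaCongruentForm W p 1),
        (∀ k, ‖x k‖ < 1) ∧ Filter.Tendsto x Filter.atTop (nhds 0) ∧
        (∃ e : ℕ, PowerSeries.C ((p : 𝓞_ℂ_[p]) ^ e) * Q ∈
          Ideal.span {PowerSeries.map (R1.unrToCpInt p) (PowerSeries.map (PowerSeries.constantCoeff (R := unrIntegers p)) L)}) ∧
        (∀ k : ℕ, (∀ y : coeffField (D k).g, ι' ((D k).ι y) = (y : ℂ)) ∧ 2 * ((p : ℤ) - 1) ∣ (D k).k - 2 ∧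
          ∃ (ΩKg : ℂ) (Ωpg : ℂ_[p]) (Lg : UnrSeries p), ΩKg ≠ 0 ∧ ‖Ωpg‖ = 1 ∧
            IsBDPLFunctionWt ι' 𝔭 κ γ (D k).g ΩKg Ωpg Lg ∧
          ∃ Ψ : UnrSeries p,
            (∃ U : PowerSeries (PowerSeries (unrIntegers p)),
              PowerSeries.map (PowerSeries.C (R := unrIntegers p)) Ψ =
                L + PowerSeries.C (PowerSeries.X - PowerSeries.C (toUnr p (x k))) * U) ∧
            (∃ e : ℕ, PowerSeries.C ((p : 𝓞_ℂ_[p]) ^ e) * PowerSeries.map (R1.unrToCpInt p) Ψ ∈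
              Ideal.span {PowerSeries.map (R1.unrToCpInt p) Lg})) ∧
        (∃ A : ℕ → UnrSeries p, ∀ ℓ : ℕ, ℓ.Prime → ¬ ℓ ∣ N →
          (∃ U : UnrSeries p, A ℓ = PowerSeries.C (toUnr p ((W.frobeniusTrace ℓ : ℤ) : ℤ_[p])) + PowerSeries.X * U) ∧
          ∀ k : ℕ, ∃ (c : unrIntegers p) (U : UnrSeries p),
            A ℓ = PowerSeries.C c + (PowerSeries.X - PowerSeries.C (toUnr p (x k))) * U ∧
            ((c : ℂ_[p]) = algebraMap (PadicAlgCl p) ℂ_[p]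
              ((D k).ι ⟨(UpperHalfPlane.qExpansion 1 ⇑(D k).g).coeff ℓ, coeff_mem_coeffField (D k).g ℓ⟩))) →
      ∃ F₀ : PowerSeries (PowerSeries ℤ_[p]),
        ¬ (PowerSeries.C (PowerSeries.X : PowerSeries ℤ_[p]) ∣ F₀) ∧
        (∃ j : ℕ, PowerSeries.C ((p : 𝓞_ℂ_[p]) ^ j) *
            PowerSeries.map (R1.toCpInt p) (PowerSeries.map (PowerSeries.constantCoeff (R := ℤ_[p])) F₀) ∈
          (XAc.charIdeal (W.baseChange K) p κ 𝔭bar ∅ γ).map (PowerSeries.map (R1.toCpInt p))) ∧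
        ∀ k : ℕ, ∃ Φ₀ : PowerSeries ℤ_[p], Φ₀ ≠ 0 ∧
          (∃ U : PowerSeries (PowerSeries ℤ_[p]),
            PowerSeries.map (PowerSeries.C (R := ℤ_[p])) Φ₀ =
              F₀ + PowerSeries.C (PowerSeries.X - PowerSeries.C (x k)) * U) ∧
          ∀ (b : padicCoeffIntegers (D k).ι →+* 𝓞_ℂ_[p]),
            (∀ y, ((b y : 𝓞_ℂ_[p]) : ℂ_[p]) =
              algebraMap (PadicAlgCl p) ℂ_[p] (padicCoeffIntegers.toPadicAlgCl (D k).ι y)) →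
          ∀ [TopologicalSpace (PowerSeries (padicCoeffIntegers (D k).ι))]
            [ContinuousSMul (PowerSeries (padicCoeffIntegers (D k).ι))
              (BigRepModule (padicCoeffIntegers (D k).ι) p (Cofree (D k).Δ.selfDualRep (padicCoeffField (D k).ι)))],
            ∃ j : ℕ, Ideal.span {PowerSeries.C ((p : 𝓞_ℂ_[p]) ^ j)} *
                (XBig.charIdeal κ ((D k).Δ.selfDualCofreeRepOver K) 𝔭bar
                  (∅ : Set (HeightOneSpectrum (𝓞 K)))).map (PowerSeries.map b) ≤
              Ideal.span {PowerSeries.map (R1.toCpInt p) Φ₀} := by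
  sorry

/-! ## §C Local copies of LANDED tree lemmas (verbatim; the farm snapshot had not yet built the two new modules at check time —
`Theorems/EisensteinPrimesBSDpOnCellCTelescopeCarrierAlgOfWitness.lean` (cruxlead-19034 g1, p729576: `evAtMap_map_C/_C/_pi`,
`C_dvd_of_evAtMap_eq_zero`, `uniqueFactorizationMonoid_unrSeries`) and `Theorems/EisensteinPrimesBSDpOnCellCRetractionSpecializationCyclic.lean`
(bsd-line-x2-p2 g18, p729512: `RetractionSpecialization.nonempty_quotSMulTop_quotient_linearEquiv'` and its four lemmas). A fold by the LEAD
replaces this section by the two imports and the tree names.) -/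

section EvalInnerCopy

variable {𝒪 : Type*} [CommRing 𝒪] [IsLocalRing 𝒪] [IsAdicComplete (IsLocalRing.maximalIdeal 𝒪) 𝒪]

theorem evAtMap_map_C (a : 𝒪) (ha : a ∈ IsLocalRing.maximalIdeal 𝒪) (g : PowerSeries 𝒪) :
    PowerSeries.map (AccumHelpers.evAt a ha).toRingHom (PowerSeries.map (PowerSeries.C (R := 𝒪)) g) = g := by
  ext n
  simp only [PowerSeries.coeff_map, RingHom.coe_coe, AlgHom.toRingHom_eq_coe]
  exact AccumHelpers.evAt_C a ha _

theorem evAtMap_C (a : 𝒪) (ha : a ∈ IsLocalRing.maximalIdeal 𝒪) (g : PowerSeries 𝒪) :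
    PowerSeries.map (AccumHelpers.evAt a ha).toRingHom (PowerSeries.C g) = PowerSeries.C (AccumHelpers.evAt a ha g) := by
  rw [PowerSeries.map_C]
  rfl

theorem evAtMap_pi (a : 𝒪) (ha : a ∈ IsLocalRing.maximalIdeal 𝒪) :
    PowerSeries.map (AccumHelpers.evAt a ha).toRingHom (PowerSeries.C (PowerSeries.X - PowerSeries.C a)) = 0 := by
  rw [evAtMap_C, map_sub, AccumHelpers.evAt_X, AccumHelpers.evAt_C, sub_self, map_zero]

theorem C_dvd_of_evAtMap_eq_zero (a : 𝒪) (ha : a ∈ IsLocalRing.maximalIdeal 𝒪)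
    (G : PowerSeries (PowerSeries 𝒪)) (h : PowerSeries.map (AccumHelpers.evAt a ha).toRingHom G = 0) :
    PowerSeries.C (PowerSeries.X - PowerSeries.C a) ∣ G := by
  have hc : ∀ i, (PowerSeries.X - PowerSeries.C a) ∣ PowerSeries.coeff i G := by
    intro i
    rw [← AccumHelpers.evAt_eq_zero_iff a ha]
    have := congrArg (PowerSeries.coeff i) h
    rw [PowerSeries.coeff_map, map_zero] at this
    exact this
  choose q hq using hc
  refine ⟨PowerSeries.mk q, PowerSeries.ext fun i => ?_⟩
  rw [PowerSeries.coeff_C_mul, PowerSeries.coeff_mk]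
  exact hq i

end EvalInnerCopy

/-- `R₀⟦T⟧` is factorial (regular local of dimension 2: Auslander–Buchsbaum), from tree theorems. (copy of p729576's) -/
theorem uniqueFactorizationMonoid_unrSeries (p : ℕ) [Fact p.Prime] :
    UniqueFactorizationMonoid (PowerSeries (unrIntegers p)) := by
  haveI := HidaLimitAlgebra.isDiscreteValuationRing_unrIntegers (p := p)
  haveI := Literature.NumberTheory.GaloisRepresentations.NearlyOrdinaryPresentationCA.isRegularLocalRing_mvPowerSeries_dvr
    (unrIntegers p) 1
  exact Literature.AlgebraicGeometry.Resolution.uniqueFactorizationMonoid_of_isRegularLocalRing _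
    (IsRegularLocalRing.of_ringEquiv (MvPowerSeries.renameEquiv (unrIntegers p) finOneEquiv.symm).toRingEquiv.symm)

namespace RetractionCopy

open Function
open scoped Pointwise

universe u₁ w₁

variable {A : Type u₁} {B : Type w₁} [CommRing A] [CommRing B] {π : B} {φ : B →+* A}

theorem mem_span_iff_map_eq_zero (hφπ : φ π = 0) (hker : ∀ b : B, φ b = 0 → π ∣ b) {r : B} :
    r ∈ Ideal.span {π} ↔ φ r = 0 := by
  rw [Ideal.mem_span_singleton]
  refine ⟨fun ⟨c, hc⟩ => ?_, hker r⟩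
  rw [hc, map_mul, hφπ, zero_mul]

theorem ker_eq_span (hφπ : φ π = 0) (hker : ∀ b : B, φ b = 0 → π ∣ b) :
    RingHom.ker φ = Ideal.span {π} := by
  ext r
  rw [RingHom.mem_ker, mem_span_iff_map_eq_zero hφπ hker]

theorem smul_top_quotient_eq_map' (I : Ideal B) :
    (π • ⊤ : Submodule B (B ⧸ I)) = Submodule.map (Submodule.mkQ I) (Ideal.span {π}) := by
  ext y
  rw [Submodule.mem_smul_pointwise_iff_exists, Submodule.mem_map]
  constructor
  · rintro ⟨z, -, rfl⟩
    obtain ⟨a, rfl⟩ := Submodule.Quotient.mk_surjective I z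
    exact ⟨π * a, Ideal.mem_span_singleton'.mpr ⟨a, mul_comm _ _⟩, rfl⟩
  · rintro ⟨h, hh, rfl⟩
    obtain ⟨a, rfl⟩ := Ideal.mem_span_singleton'.mp hh
    exact ⟨Submodule.Quotient.mk a, Submodule.mem_top, by
      rw [Submodule.mkQ_apply, mul_comm, ← smul_eq_mul, Submodule.Quotient.mk_smul]⟩

variable [Algebra A B]

theorem surjective_of_retraction (hφ : ∀ a : A, φ (algebraMap A B a) = a) : Surjective φ :=
  fun a => ⟨algebraMap A B a, hφ a⟩

theorem comap_map_eq_sup (hφ : ∀ a : A, φ (algebraMap A B a) = a) (hφπ : φ π = 0)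
    (hker : ∀ b : B, φ b = 0 → π ∣ b) (I : Ideal B) :
    (I.map φ).comap φ = I ⊔ Ideal.span {π} := by
  rw [Ideal.comap_map_of_surjective _ (surjective_of_retraction hφ), ← RingHom.ker_eq_comap_bot,
    ker_eq_span hφπ hker]

/-- `B/(I + (π)) ≃ A/φ(I)` as `A`-modules. [folklore] (copy of p729512's) -/
theorem nonempty_quotient_sup_span_linearEquiv (hφ : ∀ a : A, φ (algebraMap A B a) = a) (hφπ : φ π = 0)
    (hker : ∀ b : B, φ b = 0 → π ∣ b) (I : Ideal B) :
    Nonempty ((B ⧸ (I ⊔ Ideal.span {π})) ≃ₗ[A] (A ⧸ I.map φ)) := by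
  let cc : B →ₐ[A] A := { φ with commutes' := hφ }
  let ψ : B →ₐ[A] A ⧸ I.map φ := (Ideal.Quotient.mkₐ A _).comp cc
  have hψ : Function.Surjective ψ :=
    (Ideal.Quotient.mkₐ_surjective A _).comp (surjective_of_retraction hφ)
  have hkerψ : RingHom.ker ψ = I ⊔ Ideal.span {π} := by
    rw [← comap_map_eq_sup hφ hφπ hker I]
    ext r
    simp only [RingHom.mem_ker, Ideal.mem_comap]
    exact Ideal.Quotient.eq_zero_iff_mem
  exact ⟨(Ideal.quotientEquivAlgOfEq A hkerψ.symm).toLinearEquiv ≪≫ₗ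
    (Ideal.quotientKerAlgEquivOfSurjective hψ).toLinearEquiv⟩

/-- `(B/I)/π ≃ A/φ(I)` as `A`-modules. [folklore] (copy of p729512's) -/
theorem nonempty_quotSMulTop_quotient_linearEquiv' (hφ : ∀ a : A, φ (algebraMap A B a) = a)
    (hφπ : φ π = 0) (hker : ∀ b : B, φ b = 0 → π ∣ b) (I : Ideal B) :
    Nonempty (QuotSMulTop π (B ⧸ I) ≃ₗ[A] (A ⧸ I.map φ)) := by
  obtain ⟨e⟩ := nonempty_quotient_sup_span_linearEquiv hφ hφπ hker I
  exact ⟨((Submodule.quotEquivOfEq _ _ (smul_top_quotient_eq_map' I)) ≪≫ₗ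
    Submodule.quotientQuotientEquivQuotientSup I (Ideal.span {π})).restrictScalars A ≪≫ₗ e⟩

end RetractionCopy

/-! ## §L Coefficient lemmas (generic; theorems only) -/

section Coeff

variable {A B : Type*} [CommRing A] [CommRing B]

/-- `C a ∣ G` in `A⟦T⟧` as soon as `a` divides every coefficient. [folklore] -/
theorem C_dvd_of_forall_dvd_coeff (a : A) (G : PowerSeries A) (h : ∀ n, a ∣ PowerSeries.coeff n G) :
    PowerSeries.C a ∣ G := by
  choose q hq using h
  refine ⟨PowerSeries.mk q, PowerSeries.ext fun n => ?_⟩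
  rw [PowerSeries.coeff_C_mul, PowerSeries.coeff_mk]
  exact hq n

/-- Conversely `C a ∣ G` divides every coefficient. [folklore] -/
theorem dvd_coeff_of_C_dvd (a : A) (G : PowerSeries A) (h : PowerSeries.C a ∣ G) (n : ℕ) :
    a ∣ PowerSeries.coeff n G := by
  obtain ⟨q, rfl⟩ := h
  exact ⟨PowerSeries.coeff n q, by rw [PowerSeries.coeff_C_mul]⟩

/-- Coefficient extension commutes with the inner-constant embedding `A⟦T⟧ → A⟦X⟧⟦T⟧`. [folklore] -/
theorem map_map_map_C (f : A →+* B) (g : PowerSeries A) :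
    PowerSeries.map (PowerSeries.map f) (PowerSeries.map (PowerSeries.C (R := A)) g) =
      PowerSeries.map (PowerSeries.C (R := B)) (PowerSeries.map f g) := by
  refine PowerSeries.ext fun n => ?_
  simp only [PowerSeries.coeff_map, PowerSeries.map_C]

/-- Coefficient extension commutes with `X ↦ 0` in the inner variable. [folklore] -/
theorem map_constantCoeff_map_map (f : A →+* B) (G : PowerSeries (PowerSeries A)) :
    PowerSeries.map (PowerSeries.constantCoeff (R := B)) (PowerSeries.map (PowerSeries.map f) G) =
      PowerSeries.map f (PowerSeries.map (PowerSeries.constantCoeff (R := A)) G) := by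
  refine PowerSeries.ext fun n => ?_
  simp only [PowerSeries.coeff_map, ← PowerSeries.coeff_zero_eq_constantCoeff_apply]

end Coeff

/-! ## §K The kernel: K2-D♭ ⟹ K2-W (the registered `stub_carrierAlgW` text verbatim), by the cyclic witness -/

set_option maxHeartbeats 1600000 in
/-- **K2-W from K2-D♭.** `F :=` the image of `F₀` in `R₀⟦X⟧⟦T⟧`; `𝒩 := R₀⟦X⟧⟦T⟧ ⧸ (F)` (cyclic): `char 𝒩 = (F)`; (nondeg)/(alg∞) are
`F₀`'s read through `toUnr`/`unrToCpInt ∘ toUnr = toCpInt`; per member the regularity element is `F` (`F(x_k,T) = Φ₀ ≠ 0`), and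
`𝒩/(X − x_k)𝒩 ≃ R₀⟦T⟧/(F(x_k,T))` (x2-p2 g18, p729512) gives `char_{R₀⟦T⟧}(𝒩/(X − x_k)𝒩)·𝓞_{ℂ_p}⟦T⟧ = (Φ₀)·𝓞_{ℂ_p}⟦T⟧ ⊇ p^j·Ch(X(g_k))`.
Sorry-free. -/
theorem carrierAlgW_of_divInt
    (hD :     ∀ (W : WeierstrassCurve ℚ) [W.IsElliptic] [W.IsGloballyMinimal] (p : ℕ) [Fact p.Prime],
    ∀ (N : ℕ) [NeZero N] (K : Type) [Field K] [NumberField K] (Dt : ModularParametrizationData W N)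
      (H : HeegnerDatum N (NumberField.discr K)) (ιK : K →+* ℂ) (P : (W.baseChange K).toAffine.Point),
      CellC W p → W.conductorNorm ℤ = N →
      IsImaginaryQuadratic K → NumberField.discr K < -4 → SatisfiesHeegnerHypothesis N K →
      (W.quadraticTwist (NumberField.discr K : ℚ)).entireLFunction 1 ≠ 0 →
      WeierstrassCurve.Affine.Point.map ιK.toRatAlgHom P = heegnerPointComplex Dt H →
      ¬ (p : ℤ) ∣ Dt.c → ¬ IsOfFinAddOrder P →
      Odd (NumberField.discr K) →
      ∀ (κ : ZpExtension K p), κ.IsAnticyclotomic →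
        ∀ (γ : Field.absoluteGaloisGroup K) [Fact (κ.IsTopGenerator γ)]
          (𝔭 : HeightOneSpectrum (𝓞 K)), ((p : ℕ) : 𝓞 K) ∈ 𝔭.asIdeal →
          𝔭.asIdeal.ramificationIdx (𝓞 ℚ) = 1 → 𝔭.asIdeal.inertiaDeg (𝓞 ℚ) = 1 →
          ∀ (𝔭bar : HeightOneSpectrum (𝓞 K)), ((p : ℕ) : 𝓞 K) ∈ 𝔭bar.asIdeal → 𝔭bar ≠ 𝔭 →
            ((Ideal.span {(p : ℤ)}).primesOver (𝓞 K)).ncard = 2 →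
          ∀ (f : CuspForm (CongruenceSubgroup.Gamma0 N) 2), IsNewformOf W f →
            ∀ (ι' : PadicAlgCl p ≃+* ℂ),
              (∀ (w : InfinitePlace K) (k : 𝓞 K),
                k ∈ 𝔭.asIdeal ↔ ‖ι'.symm (w.embedding (k : K))‖ < 1) →
              ∀ (ΩK : ℂ) (Ωp : ℂ_[p]) (Q : PowerSeries 𝓞_ℂ_[p]), ΩK ≠ 0 → ‖Ωp‖ = 1 →
                R1.IsBDPLFunctionInt p ι' 𝔭 κ γ f ΩK Ωp Q →
      ∀ (L : PowerSeries (PowerSeries (unrIntegers p))) (x : ℕ → ℤ_[p]) (D : ℕ → Skinner2016.HidaCongruentForm W p 1),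
        (∀ k, ‖x k‖ < 1) ∧ Filter.Tendsto x Filter.atTop (nhds 0) ∧
        (∃ e : ℕ, PowerSeries.C ((p : 𝓞_ℂ_[p]) ^ e) * Q ∈
          Ideal.span {PowerSeries.map (R1.unrToCpInt p) (PowerSeries.map (PowerSeries.constantCoeff (R := unrIntegers p)) L)}) ∧
        (∀ k : ℕ, (∀ y : coeffField (D k).g, ι' ((D k).ι y) = (y : ℂ)) ∧ 2 * ((p : ℤ) - 1) ∣ (D k).k - 2 ∧
          ∃ (ΩKg : ℂ) (Ωpg : ℂ_[p]) (Lg : UnrSeries p), ΩKg ≠ 0 ∧ ‖Ωpg‖ = 1 ∧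
            IsBDPLFunctionWt ι' 𝔭 κ γ (D k).g ΩKg Ωpg Lg ∧
          ∃ Ψ : UnrSeries p,
            (∃ U : PowerSeries (PowerSeries (unrIntegers p)),
              PowerSeries.map (PowerSeries.C (R := unrIntegers p)) Ψ =
                L + PowerSeries.C (PowerSeries.X - PowerSeries.C (toUnr p (x k))) * U) ∧
            (∃ e : ℕ, PowerSeries.C ((p : 𝓞_ℂ_[p]) ^ e) * PowerSeries.map (R1.unrToCpInt p) Ψ ∈
              Ideal.span {PowerSeries.map (R1.unrToCpInt p) Lg})) ∧
        (∃ A : ℕ → UnrSeries p, ∀ ℓ : ℕ, ℓ.Prime → ¬ ℓ ∣ N →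
          (∃ U : UnrSeries p, A ℓ = PowerSeries.C (toUnr p ((W.frobeniusTrace ℓ : ℤ) : ℤ_[p])) + PowerSeries.X * U) ∧
          ∀ k : ℕ, ∃ (c : unrIntegers p) (U : UnrSeries p),
            A ℓ = PowerSeries.C c + (PowerSeries.X - PowerSeries.C (toUnr p (x k))) * U ∧
            ((c : ℂ_[p]) = algebraMap (PadicAlgCl p) ℂ_[p]
              ((D k).ι ⟨(UpperHalfPlane.qExpansion 1 ⇑(D k).g).coeff ℓ, coeff_mem_coeffField (D k).g ℓ⟩))) →
      ∃ F₀ : PowerSeries (PowerSeries ℤ_[p]),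
        ¬ (PowerSeries.C (PowerSeries.X : PowerSeries ℤ_[p]) ∣ F₀) ∧
        (∃ j : ℕ, PowerSeries.C ((p : 𝓞_ℂ_[p]) ^ j) *
            PowerSeries.map (R1.toCpInt p) (PowerSeries.map (PowerSeries.constantCoeff (R := ℤ_[p])) F₀) ∈
          (XAc.charIdeal (W.baseChange K) p κ 𝔭bar ∅ γ).map (PowerSeries.map (R1.toCpInt p))) ∧
        ∀ k : ℕ, ∃ Φ₀ : PowerSeries ℤ_[p], Φ₀ ≠ 0 ∧
          (∃ U : PowerSeries (PowerSeries ℤ_[p]),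
            PowerSeries.map (PowerSeries.C (R := ℤ_[p])) Φ₀ =
              F₀ + PowerSeries.C (PowerSeries.X - PowerSeries.C (x k)) * U) ∧
          ∀ (b : padicCoeffIntegers (D k).ι →+* 𝓞_ℂ_[p]),
            (∀ y, ((b y : 𝓞_ℂ_[p]) : ℂ_[p]) =
              algebraMap (PadicAlgCl p) ℂ_[p] (padicCoeffIntegers.toPadicAlgCl (D k).ι y)) →
          ∀ [TopologicalSpace (PowerSeries (padicCoeffIntegers (D k).ι))]
            [ContinuousSMul (PowerSeries (padicCoeffIntegers (D k).ι))
              (BigRepModule (padicCoeffIntegers (D k).ι) p (Cofree (D k).Δ.selfDualRep (padicCoeffField (D k).ι)))],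
            ∃ j : ℕ, Ideal.span {PowerSeries.C ((p : 𝓞_ℂ_[p]) ^ j)} *
                (XBig.charIdeal κ ((D k).Δ.selfDualCofreeRepOver K) 𝔭bar
                  (∅ : Set (HeightOneSpectrum (𝓞 K)))).map (PowerSeries.map b) ≤
              Ideal.span {PowerSeries.map (R1.toCpInt p) Φ₀}) :
    ∀ (W : WeierstrassCurve ℚ) [W.IsElliptic] [W.IsGloballyMinimal] (p : ℕ) [Fact p.Prime],
    ∀ (N : ℕ) [NeZero N] (K : Type) [Field K] [NumberField K] (Dt : ModularParametrizationData W N)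
      (H : HeegnerDatum N (NumberField.discr K)) (ιK : K →+* ℂ) (P : (W.baseChange K).toAffine.Point),
      CellC W p → W.conductorNorm ℤ = N →
      IsImaginaryQuadratic K → NumberField.discr K < -4 → SatisfiesHeegnerHypothesis N K →
      (W.quadraticTwist (NumberField.discr K : ℚ)).entireLFunction 1 ≠ 0 →
      WeierstrassCurve.Affine.Point.map ιK.toRatAlgHom P = heegnerPointComplex Dt H →
      ¬ (p : ℤ) ∣ Dt.c → ¬ IsOfFinAddOrder P →
      Odd (NumberField.discr K) →
      ∀ (κ : ZpExtension K p), κ.IsAnticyclotomic →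
        ∀ (γ : Field.absoluteGaloisGroup K) [Fact (κ.IsTopGenerator γ)]
          (𝔭 : HeightOneSpectrum (𝓞 K)), ((p : ℕ) : 𝓞 K) ∈ 𝔭.asIdeal →
          𝔭.asIdeal.ramificationIdx (𝓞 ℚ) = 1 → 𝔭.asIdeal.inertiaDeg (𝓞 ℚ) = 1 →
          ∀ (𝔭bar : HeightOneSpectrum (𝓞 K)), ((p : ℕ) : 𝓞 K) ∈ 𝔭bar.asIdeal → 𝔭bar ≠ 𝔭 →
            ((Ideal.span {(p : ℤ)}).primesOver (𝓞 K)).ncard = 2 →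
          ∀ (f : CuspForm (CongruenceSubgroup.Gamma0 N) 2), IsNewformOf W f →
            ∀ (ι' : PadicAlgCl p ≃+* ℂ),
              (∀ (w : InfinitePlace K) (k : 𝓞 K),
                k ∈ 𝔭.asIdeal ↔ ‖ι'.symm (w.embedding (k : K))‖ < 1) →
              ∀ (ΩK : ℂ) (Ωp : ℂ_[p]) (Q : PowerSeries 𝓞_ℂ_[p]), ΩK ≠ 0 → ‖Ωp‖ = 1 →
                R1.IsBDPLFunctionInt p ι' 𝔭 κ γ f ΩK Ωp Q →
      ∀ (L : PowerSeries (PowerSeries (unrIntegers p))) (x : ℕ → ℤ_[p]) (D : ℕ → Skinner2016.HidaCongruentForm W p 1),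
        (∀ k, ‖x k‖ < 1) ∧ Filter.Tendsto x Filter.atTop (nhds 0) ∧
        (∃ e : ℕ, PowerSeries.C ((p : 𝓞_ℂ_[p]) ^ e) * Q ∈
          Ideal.span {PowerSeries.map (R1.unrToCpInt p) (PowerSeries.map (PowerSeries.constantCoeff (R := unrIntegers p)) L)}) ∧
        (∀ k : ℕ, (∀ y : coeffField (D k).g, ι' ((D k).ι y) = (y : ℂ)) ∧ 2 * ((p : ℤ) - 1) ∣ (D k).k - 2 ∧
          ∃ (ΩKg : ℂ) (Ωpg : ℂ_[p]) (Lg : UnrSeries p), ΩKg ≠ 0 ∧ ‖Ωpg‖ = 1 ∧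
            IsBDPLFunctionWt ι' 𝔭 κ γ (D k).g ΩKg Ωpg Lg ∧
          ∃ Ψ : UnrSeries p,
            (∃ U : PowerSeries (PowerSeries (unrIntegers p)),
              PowerSeries.map (PowerSeries.C (R := unrIntegers p)) Ψ =
                L + PowerSeries.C (PowerSeries.X - PowerSeries.C (toUnr p (x k))) * U) ∧
            (∃ e : ℕ, PowerSeries.C ((p : 𝓞_ℂ_[p]) ^ e) * PowerSeries.map (R1.unrToCpInt p) Ψ ∈
              Ideal.span {PowerSeries.map (R1.unrToCpInt p) Lg})) ∧
        (∃ A : ℕ → UnrSeries p, ∀ ℓ : ℕ, ℓ.Prime → ¬ ℓ ∣ N →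
          (∃ U : UnrSeries p, A ℓ = PowerSeries.C (toUnr p ((W.frobeniusTrace ℓ : ℤ) : ℤ_[p])) + PowerSeries.X * U) ∧
          ∀ k : ℕ, ∃ (c : unrIntegers p) (U : UnrSeries p),
            A ℓ = PowerSeries.C c + (PowerSeries.X - PowerSeries.C (toUnr p (x k))) * U ∧
            ((c : ℂ_[p]) = algebraMap (PadicAlgCl p) ℂ_[p]
              ((D k).ι ⟨(UpperHalfPlane.qExpansion 1 ⇑(D k).g).coeff ℓ, coeff_mem_coeffField (D k).g ℓ⟩))) →
      ∃ (F : PowerSeries (PowerSeries (unrIntegers p)))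
        (𝒩 : Type) (_ : AddCommGroup 𝒩) (_ : Module (PowerSeries (PowerSeries (unrIntegers p))) 𝒩)
        (_ : Module (PowerSeries (unrIntegers p)) 𝒩)
        (_ : IsScalarTower (PowerSeries (unrIntegers p)) (PowerSeries (PowerSeries (unrIntegers p))) 𝒩)
        (_ : Module.Finite (PowerSeries (PowerSeries (unrIntegers p))) 𝒩),
        Literature.NumberTheory.EllipticCurves.Module.charIdeal (PowerSeries (PowerSeries (unrIntegers p))) 𝒩 =
          Ideal.span {F} ∧
        ¬ (PowerSeries.C (PowerSeries.X : PowerSeries (unrIntegers p)) ∣ F) ∧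
        (∃ j : ℕ, PowerSeries.C ((p : 𝓞_ℂ_[p]) ^ j) *
            PowerSeries.map (R1.unrToCpInt p) (PowerSeries.map (PowerSeries.constantCoeff (R := unrIntegers p)) F) ∈
          (XAc.charIdeal (W.baseChange K) p κ 𝔭bar ∅ γ).map (PowerSeries.map (R1.toCpInt p))) ∧
        ∀ k : ℕ,
          (∃ s : PowerSeries (PowerSeries (unrIntegers p)),
            ¬ (PowerSeries.C (PowerSeries.X - PowerSeries.C (toUnr p (x k))) ∣ s) ∧ ∀ m : 𝒩, s • m = 0) ∧
          ∀ (b : padicCoeffIntegers (D k).ι →+* 𝓞_ℂ_[p]),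
            (∀ y, ((b y : 𝓞_ℂ_[p]) : ℂ_[p]) =
              algebraMap (PadicAlgCl p) ℂ_[p] (padicCoeffIntegers.toPadicAlgCl (D k).ι y)) →
          ∀ [TopologicalSpace (PowerSeries (padicCoeffIntegers (D k).ι))]
            [ContinuousSMul (PowerSeries (padicCoeffIntegers (D k).ι))
              (BigRepModule (padicCoeffIntegers (D k).ι) p (Cofree (D k).Δ.selfDualRep (padicCoeffField (D k).ι)))],
            ∃ j : ℕ, Ideal.span {PowerSeries.C ((p : 𝓞_ℂ_[p]) ^ j)} *
                (XBig.charIdeal κ ((D k).Δ.selfDualCofreeRepOver K) 𝔭bar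
                  (∅ : Set (HeightOneSpectrum (𝓞 K)))).map (PowerSeries.map b) ≤
              (Literature.NumberTheory.EllipticCurves.Module.charIdeal (PowerSeries (unrIntegers p))
                  (QuotSMulTop (PowerSeries.C (PowerSeries.X - PowerSeries.C (toUnr p (x k)))) 𝒩)).map
                (PowerSeries.map (R1.unrToCpInt p)) := by
  intro W _ _ p _ N _ K _ _ Dt H ιK P hC hN hK hdisc hHeeg hL1 hP hc hfin hodd κ hκ γ _ 𝔭 h𝔭 hram hdeg 𝔭bar
    h𝔭bar hne hsp f hf ι' hι' ΩK Ωp Q hΩK hΩp hQ L x D hpkg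
  obtain ⟨F₀, hX₀, halg₀, hmem₀⟩ :=
    hD W p N K Dt H ιK P hC hN hK hdisc hHeeg hL1 hP hc hfin hodd κ hκ γ 𝔭 h𝔭 hram hdeg 𝔭bar h𝔭bar hne
      hsp f hf ι' hι' ΩK Ωp Q hΩK hΩp hQ L x D hpkg
  have hxk : ∀ k, ‖x k‖ < 1 := hpkg.1
  -- the receptacle `R₀ = unrIntegers p`: a complete DVR with uniformiser `p`; `R₀⟦T⟧`, `R₀⟦X⟧⟦T⟧` factorial
  haveI := HidaLimitAlgebra.isDiscreteValuationRing_unrIntegers (p := p)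
  haveI : IsAdicComplete (IsLocalRing.maximalIdeal (unrIntegers p)) (unrIntegers p) :=
    CongruentShaFreeCutUnrSeriesWeierstrass.isAdicComplete_maximalIdeal
  haveI : UniqueFactorizationMonoid (PowerSeries (PowerSeries (unrIntegers p))) :=
    Literature.NumberTheory.IwasawaTheory.uniqueFactorizationMonoid_powerSeries_powerSeries (unrIntegers p)
  haveI : UniqueFactorizationMonoid (PowerSeries (unrIntegers p)) := uniqueFactorizationMonoid_unrSeries p
  have hirr : Irreducible ((p : ℕ) : unrIntegers p) := HidaLimitAlgebra.irreducible_natCast_p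
  have hpmem : ((p : ℕ) : unrIntegers p) ∈ IsLocalRing.maximalIdeal (unrIntegers p) :=
    (IsLocalRing.mem_maximalIdeal _).mpr hirr.not_isUnit
  have hpt : ∀ z : ℤ_[p], ‖z‖ < 1 → toUnr p z ∈ IsLocalRing.maximalIdeal (unrIntegers p) := by
    intro z hz
    obtain ⟨y, hy⟩ := (PadicInt.norm_lt_one_iff_dvd z).mp hz
    rw [hy, map_mul, map_natCast]
    exact Ideal.mul_mem_right _ _ hpmem
  -- the coefficient maps `Λ → Λ_{R₀}` and `ℤ_p⟦X⟧⟦T⟧ → R₀⟦X⟧⟦T⟧`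
  set Φ₁ : PowerSeries ℤ_[p] →+* PowerSeries (unrIntegers p) := PowerSeries.map (toUnr p) with hΦ₁
  set Φ₂ : PowerSeries (PowerSeries ℤ_[p]) →+* PowerSeries (PowerSeries (unrIntegers p)) :=
    PowerSeries.map Φ₁ with hΦ₂
  have hΦ₁inj : Function.Injective Φ₁ := map_toUnr_injective
  set F : PowerSeries (PowerSeries (unrIntegers p)) := Φ₂ F₀ with hFdef
  -- (nondeg) transported along the injective `toUnr`
  have hXF : ¬ (PowerSeries.C (PowerSeries.X : PowerSeries (unrIntegers p)) ∣ F) := by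
    intro hdvd
    apply hX₀
    refine C_dvd_of_forall_dvd_coeff _ _ fun n => ?_
    have h1 := dvd_coeff_of_C_dvd _ _ hdvd n
    rw [PowerSeries.X_dvd_iff] at h1 ⊢
    rw [hFdef, hΦ₂, PowerSeries.coeff_map, hΦ₁, ← PowerSeries.coeff_zero_eq_constantCoeff_apply,
      PowerSeries.coeff_map, PowerSeries.coeff_zero_eq_constantCoeff_apply] at h1
    exact toUnr_injective (by rw [h1, map_zero])
  have hF0 : F ≠ 0 := fun h => hXF (h ▸ dvd_zero _)
  refine ⟨F, PowerSeries (PowerSeries (unrIntegers p)) ⧸ Ideal.span {F}, inferInstance, inferInstance,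
    inferInstance, inferInstance, inferInstance, ?_, hXF, ?_, fun k => ?_⟩
  · -- `char 𝒩 = (F)` for the cyclic witness
    exact Literature.NumberTheory.EllipticCurves.Module.charIdeal_quotient_span_singleton hF0
  · -- (alg∞): `F(0,T)` read in `𝓞_{ℂ_p}⟦T⟧` is `F₀(0,T)` read there
    obtain ⟨j, hj⟩ := halg₀
    refine ⟨j, ?_⟩
    have hread : PowerSeries.map (R1.unrToCpInt p)
        (PowerSeries.map (PowerSeries.constantCoeff (R := unrIntegers p)) F) =
        PowerSeries.map (R1.toCpInt p) (PowerSeries.map (PowerSeries.constantCoeff (R := ℤ_[p])) F₀) := by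
      rw [hFdef, hΦ₂, hΦ₁, map_constantCoeff_map_map, R1.map_unrToCpInt_map_toUnr]
    rw [hread]
    exact hj
  · obtain ⟨Φ₀, hΦ0, ⟨U, hU⟩, hctrl⟩ := hmem₀ k
    have ha : toUnr p (x k) ∈ IsLocalRing.maximalIdeal (unrIntegers p) := hpt _ (hxk k)
    set π : PowerSeries (PowerSeries (unrIntegers p)) :=
      PowerSeries.C (PowerSeries.X - PowerSeries.C (toUnr p (x k))) with hπ
    -- the evaluation retraction `φ : R₀⟦X⟧⟦T⟧ → R₀⟦T⟧`, `X ↦ x_k`, kernel `(π)` (landed §E, p729576)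
    let φ : PowerSeries (PowerSeries (unrIntegers p)) →+* PowerSeries (unrIntegers p) :=
      PowerSeries.map (AccumHelpers.evAt (toUnr p (x k)) ha).toRingHom
    have hφC : ∀ g : PowerSeries (unrIntegers p),
        φ (algebraMap (PowerSeries (unrIntegers p)) (PowerSeries (PowerSeries (unrIntegers p))) g) = g :=
      fun g => evAtMap_map_C _ ha g
    have hφC' : ∀ g : PowerSeries (unrIntegers p),
        φ (PowerSeries.map (PowerSeries.C (R := unrIntegers p)) g) = g :=
      fun g => evAtMap_map_C _ ha g
    have hφπ : φ π = 0 := evAtMap_pi _ ha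
    have hφker : ∀ b : PowerSeries (PowerSeries (unrIntegers p)), φ b = 0 → π ∣ b :=
      fun b hb => C_dvd_of_evAtMap_eq_zero _ ha b hb
    -- the remainder identity transported: `Φ₀` (read in `R₀⟦T⟧`) `≡ F (mod π)`
    have hid : PowerSeries.map (PowerSeries.C (R := unrIntegers p)) (Φ₁ Φ₀) = F + π * Φ₂ U := by
      have h1 := congrArg Φ₂ hU
      rw [map_add, map_mul, hΦ₂, map_map_map_C, PowerSeries.map_C, map_sub, PowerSeries.map_X, ← hΦ₂] at h1
      rw [h1, hFdef, hπ, hΦ₁, PowerSeries.map_C]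
    have hφF : φ F = Φ₁ Φ₀ := by
      have h1 := congrArg φ hid
      rw [map_add, map_mul, hφπ, zero_mul, add_zero, hφC'] at h1
      exact h1.symm
    have hΦ10 : Φ₁ Φ₀ ≠ 0 := fun h => hΦ0 (hΦ₁inj (by rw [h, map_zero]))
    refine ⟨⟨F, ?_, ?_⟩, ?_⟩
    · -- regularity: `π ∤ F` since `F(x_k,T) = Φ₀ ≠ 0`
      rintro ⟨V, hV⟩
      apply hΦ10
      rw [← hφF, hV, map_mul, hφπ, zero_mul]
    · -- `F` kills `𝒩 = R₀⟦X⟧⟦T⟧ ⧸ (F)`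
      intro m
      obtain ⟨G, rfl⟩ := Ideal.Quotient.mk_surjective m
      change Ideal.Quotient.mk (Ideal.span {F}) (F * G) = 0
      exact Ideal.Quotient.eq_zero_iff_mem.mpr (Ideal.mul_mem_right _ _ (Ideal.subset_span rfl))
    · -- control read in `𝓞_{ℂ_p}⟦T⟧`: `char(𝒩/π𝒩)·𝓞⟦T⟧ = (Φ₀)·𝓞⟦T⟧ ⊇ p^j·Ch(X(g_k))·𝓞⟦T⟧`
      intro b hb _ _
      obtain ⟨j, hj⟩ := hctrl b hb
      refine ⟨j, hj.trans (le_of_eq ?_)⟩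
      obtain ⟨e⟩ := RetractionCopy.nonempty_quotSMulTop_quotient_linearEquiv'
        (A := PowerSeries (unrIntegers p)) hφC hφπ hφker (Ideal.span {F})
      rw [Literature.NumberTheory.EllipticCurves.Module.charIdeal_eq_of_linearEquiv e, Ideal.map_span,
        Set.image_singleton, hφF,
        Literature.NumberTheory.EllipticCurves.Module.charIdeal_quotient_span_singleton hΦ10, Ideal.map_span,
        Set.image_singleton, hΦ₁, R1.map_unrToCpInt_map_toUnr]

end Summit.BirchSwinnertonDyer.BirchSwinnertonDyer.Cruxes.BSDpOnCellC.Telescope.K2Int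

end
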